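import Mathlib
import Literature.Computability.AlgebraicComplexity.PermanentIrreducible
import Literature.Computability.AlgebraicComplexity.DeterminantalConormalBoundKernelAlgebra
import Summits.ValiantsHypothesis.ValiantsHypothesis.Theorems.ChowBorderDepth3ChowBorderBoundCoeffGraphSubst

/-!
# Stub `stub_degenerationDatum` of crux `ChowBorderDepth3.ChowBorderBound`
# (stmt-ValiantsHypothesis-5936), line `registered`

Stub W6 of the top-fan-in-two wave: the one-parameter torus
`x_{(i,j)} ↦ τ^{wt (i,j)} x_{(i,j)}` with the weights `wt (i, j) := n·i + j + 1`, realised as the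
algebra map `θ := aeval (fun v ↦ τ^{wt v} · X (some v))` from `ℂ[x_v : v ∈ Fin n × Fin n]` to
`ℂ[τ, x_v]` (`τ := X none`).

* (a) the permanent is a *semi-invariant*: `θ per_n = τ^W · per_n` with
  `W = Σ_i (n·i + (i+1))`, because every permutation monomial `Π_i x_{(ρ i, i)}` has the same
  weight `Σ_i wt (ρ i, i) = n Σ_i ρ i + Σ_i (i + 1) = W`;
* (b) every product of non-zero affine forms *degenerates* to a non-zero scalar multiple of a
  monomial: `θ (Π_j ℓ_j) = τ^M · (κ x^β + τ Q)` with `κ ≠ 0`.  For one affine form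
  `ℓ = c₀ + Σ_v c_v x_v ≠ 0`: if `c₀ ≠ 0` take `M = 0`, `κ x^β = c₀` (all weights are `≥ 1`);
  otherwise the weights are injective on `Fin n × Fin n`, so among the `v` with `c_v ≠ 0` there is
  a unique one `v₀` of least weight, and `M = wt v₀`, `κ x^β = c_{v₀} x_{v₀}`.  Such data multiply
  (`τ^{M₁}(m₁ + τQ₁) · τ^{M₂}(m₂ + τQ₂) = τ^{M₁+M₂}(m₁m₂ + τ(…))`), which handles products.

## References

Folklore (initial forms with respect to a generic one-parameter subgroup).
-/

noncomputable section

-- `Summit.ValiantsHypothesis.ValiantsHypothesis.…` is the tree's mandated single-conjunct layout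
-- (Sub = Summit), so the duplicated namespace component is intended.
set_option linter.dupNamespace false

namespace Summit.ValiantsHypothesis.ValiantsHypothesis.Theorems.ChowBorderBound.DegenerationDatum

open MvPolynomial Literature.Computability.AlgebraicComplexity

/-! ## (a) The permanent is a semi-invariant of the torus -/

/-- The weight of a permutation monomial does not depend on the permutation:
`Σ_i (n·ρ i + i + 1) = Σ_i (n·i + (i + 1))`. [folklore] -/
theorem sum_weight_perm (n : ℕ) (ρ : Equiv.Perm (Fin n)) :
    ∑ i : Fin n, (n * (ρ i : ℕ) + (i : ℕ) + 1) = ∑ i : Fin n, (n * (i : ℕ) + ((i : ℕ) + 1)) := by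
  have hρ : ∑ i : Fin n, (ρ i : ℕ) = ∑ i : Fin n, (i : ℕ) :=
    Fintype.sum_equiv ρ (fun i => (ρ i : ℕ)) (fun i => (i : ℕ)) fun _ => rfl
  simp only [Finset.sum_add_distrib, ← Finset.mul_sum, hρ, add_assoc]

/-- **(a)** `θ per_n = τ^W · per_n`: the permanent is a semi-invariant of weight
`W = Σ_i (n·i + (i+1))` for the torus `x_{(i,j)} ↦ τ^{n i + j + 1} x_{(i,j)}`. [folklore] -/
theorem aeval_torus_perPoly (n : ℕ) :
    MvPolynomial.aeval (fun v : Fin n × Fin n =>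
        (MvPolynomial.X (none : Option (Fin n × Fin n)) :
            MvPolynomial (Option (Fin n × Fin n)) ℂ) ^ (n * (v.1 : ℕ) + (v.2 : ℕ) + 1) *
          MvPolynomial.X (some v)) (perPoly (Fin n) ℂ) =
      (MvPolynomial.X (none : Option (Fin n × Fin n)) : MvPolynomial (Option (Fin n × Fin n)) ℂ) ^
          (∑ i : Fin n, (n * (i : ℕ) + ((i : ℕ) + 1))) *
        MvPolynomial.rename some (perPoly (Fin n) ℂ) := by
  rw [CoeffGraphSubst.aeval_perPoly_eq_sum, rename_eq_aeval, CoeffGraphSubst.aeval_perPoly_eq_sum,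
    Finset.mul_sum]
  refine Finset.sum_congr rfl fun ρ _ => ?_
  rw [Finset.prod_mul_distrib, Finset.prod_pow_eq_pow_sum, sum_weight_perm n ρ]
  rfl

/-! ## (b) Degeneration data of products of affine forms -/

section Datum

variable {σ : Type*}

/-- Extracting the term of least exponent from a sum `Σ_{o ∈ T} a_o t^{e_o} m_o` whose exponents
are strictly larger than `e_{o₀}` away from `o₀ ∈ T`. [folklore] -/
theorem sum_eq_pow_mul_of_lt {ι A : Type*} [CommSemiring A] [DecidableEq ι] (T : Finset ι)
    (a m : ι → A) (e : ι → ℕ) (t : A) {o₀ : ι} (h₀ : o₀ ∈ T)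
    (hlt : ∀ o ∈ T, o ≠ o₀ → e o₀ < e o) :
    ∑ o ∈ T, a o * (t ^ e o * m o) =
      t ^ e o₀ * (a o₀ * m o₀ + t * ∑ o ∈ T.erase o₀, a o * t ^ (e o - e o₀ - 1) * m o) := by
  rw [← Finset.add_sum_erase T _ h₀, mul_add, Finset.mul_sum, Finset.mul_sum]
  congr 1
  · ring
  · refine Finset.sum_congr rfl fun o ho => ?_
    obtain ⟨hne, hoT⟩ := Finset.mem_erase.1 ho
    obtain ⟨k, hk⟩ := Nat.exists_eq_add_of_lt (hlt o hoT hne)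
    rw [hk, show e o₀ + k + 1 - e o₀ - 1 = k by omega]
    ring

/-- Degeneration datum of a non-zero affine form written out as `c₀ + Σ_v c_v x_v`, for an
injective weight `w ≥ 1`: `c₀ + Σ_v c_v τ^{w v} x_v = τ^M (κ x^β + τ Q)` with `κ ≠ 0`.
[folklore] -/
theorem linear_datum [Fintype σ] [DecidableEq σ] (w : σ → ℕ) (hw : Function.Injective w)
    (hpos : ∀ v, 1 ≤ w v) (c₀ : ℂ) (c : σ → ℂ) (h : c₀ ≠ 0 ∨ ∃ v, c v ≠ 0) :
    ∃ (M : ℕ) (β : σ →₀ ℕ) (κ : ℂ) (Q : MvPolynomial (Option σ) ℂ), κ ≠ 0 ∧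
      C c₀ + ∑ v, C (c v) * ((X none : MvPolynomial (Option σ) ℂ) ^ w v * X (some v)) =
        (X none : MvPolynomial (Option σ) ℂ) ^ M *
          (rename some (C κ * monomial β 1) + X none * Q) := by
  by_cases h0 : c₀ = 0
  · -- no constant term: extract the (unique) term of least weight
    have hS : (Finset.univ.filter fun v => c v ≠ 0).Nonempty := by
      rcases h with h | ⟨v, hv⟩
      · exact absurd h0 h
      · exact ⟨v, Finset.mem_filter.2 ⟨Finset.mem_univ _, hv⟩⟩
    obtain ⟨v₀, hv₀, hmin⟩ := Finset.exists_min_image _ w hS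
    have hc₀ : c v₀ ≠ 0 := (Finset.mem_filter.1 hv₀).2
    refine ⟨w v₀, Finsupp.single v₀ 1, c v₀,
      ∑ v ∈ (Finset.univ.filter fun v => c v ≠ 0).erase v₀,
        C (c v) * X none ^ (w v - w v₀ - 1) * X (some v), hc₀, ?_⟩
    rw [h0, C_0, zero_add, C_mul_monomial, mul_one, rename_monomial, Finsupp.mapDomain_single,
      ← C_mul_X_eq_monomial,
      ← Finset.sum_filter_of_ne (p := fun v => c v ≠ 0) fun v _ hv hcv => hv (by
        rw [hcv, C_0, zero_mul])]
    refine sum_eq_pow_mul_of_lt _ (fun v => C (c v)) (fun v => X (some v)) w (X none) hv₀ ?_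
    intro v hv hne
    exact lt_of_le_of_ne (hmin v hv) fun heq => hne (hw heq).symm
  · -- non-zero constant term: it is the initial form
    refine ⟨0, 0, c₀, ∑ v, C (c v) * X none ^ (w v - 1) * X (some v), h0, ?_⟩
    rw [pow_zero, one_mul, C_mul_monomial, mul_one, rename_monomial, Finsupp.mapDomain_zero,
      monomial_zero', Finset.mul_sum]
    congr 1
    refine Finset.sum_congr rfl fun v _ => ?_
    obtain ⟨k, hk⟩ := Nat.exists_eq_add_of_le (hpos v)
    rw [hk, Nat.add_sub_cancel_left, pow_add, pow_one]
    ring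

/-- Degeneration datum of one non-zero affine form `ℓ` (`totalDegree ℓ ≤ 1`) under the torus
`x_v ↦ τ^{w v} x_v` with injective weights `w ≥ 1`: `θ ℓ = τ^M (κ x^β + τ Q)`, `κ ≠ 0`.
[folklore] -/
theorem affine_datum [Fintype σ] [DecidableEq σ] (w : σ → ℕ) (hw : Function.Injective w)
    (hpos : ∀ v, 1 ≤ w v) {lam : MvPolynomial σ ℂ} (hdeg : lam.totalDegree ≤ 1)
    (hne : lam ≠ 0) :
    ∃ (M : ℕ) (β : σ →₀ ℕ) (κ : ℂ) (Q : MvPolynomial (Option σ) ℂ), κ ≠ 0 ∧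
      aeval (fun v : σ => (X none : MvPolynomial (Option σ) ℂ) ^ w v * X (some v)) lam =
        (X none : MvPolynomial (Option σ) ℂ) ^ M *
          (rename some (C κ * monomial β 1) + X none * Q) := by
  have hθ : aeval (fun v : σ => (X none : MvPolynomial (Option σ) ℂ) ^ w v * X (some v)) lam =
      C (coeff 0 lam) + ∑ v, C (coeff (Finsupp.single v 1) lam) *
        ((X none : MvPolynomial (Option σ) ℂ) ^ w v * X (some v)) := by
    conv_lhs => rw [DeterminantalConormal.eq_C_add_sum_of_totalDegree_le_one hdeg]
    simp only [map_add, map_sum, map_mul, aeval_C, aeval_X, algebraMap_eq]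
  have h : coeff 0 lam ≠ 0 ∨ ∃ v, coeff (Finsupp.single v 1) lam ≠ 0 := by
    by_contra hcon
    refine hne ((DeterminantalConormal.eq_zero_iff_of_totalDegree_le_one hdeg).2 ⟨?_, fun v => ?_⟩)
    · by_contra h0
      exact hcon (Or.inl h0)
    · by_contra hv
      exact hcon (Or.inr ⟨v, hv⟩)
  obtain ⟨M, β, κ, Q, hκ, hEq⟩ := linear_datum w hw hpos _ _ h
  exact ⟨M, β, κ, Q, hκ, hθ.trans hEq⟩

/-- The trivial datum of `1 = τ^0 (1 · x^0 + τ · 0)`. [folklore] -/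
theorem one_datum :
    ∃ (M : ℕ) (β : σ →₀ ℕ) (κ : ℂ) (Q : MvPolynomial (Option σ) ℂ), κ ≠ 0 ∧
      (1 : MvPolynomial (Option σ) ℂ) =
        (X none : MvPolynomial (Option σ) ℂ) ^ M *
          (rename some (C κ * monomial β 1) + X none * Q) :=
  ⟨0, 0, 1, 0, one_ne_zero, by
    rw [pow_zero, one_mul, mul_zero, add_zero, C_1, one_mul, rename_monomial,
      Finsupp.mapDomain_zero, monomial_zero', C_1]⟩

/-- Degeneration data multiply:
`τ^{M₁}(κ₁ x^{β₁} + τQ₁) · τ^{M₂}(κ₂ x^{β₂} + τQ₂) = τ^{M₁+M₂}(κ₁κ₂ x^{β₁+β₂} + τ Q)`.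
[folklore] -/
theorem mul_datum {f g : MvPolynomial (Option σ) ℂ}
    (hf : ∃ (M : ℕ) (β : σ →₀ ℕ) (κ : ℂ) (Q : MvPolynomial (Option σ) ℂ), κ ≠ 0 ∧
      f = (X none : MvPolynomial (Option σ) ℂ) ^ M *
        (rename some (C κ * monomial β 1) + X none * Q))
    (hg : ∃ (M : ℕ) (β : σ →₀ ℕ) (κ : ℂ) (Q : MvPolynomial (Option σ) ℂ), κ ≠ 0 ∧
      g = (X none : MvPolynomial (Option σ) ℂ) ^ M *
        (rename some (C κ * monomial β 1) + X none * Q)) :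
    ∃ (M : ℕ) (β : σ →₀ ℕ) (κ : ℂ) (Q : MvPolynomial (Option σ) ℂ), κ ≠ 0 ∧
      f * g = (X none : MvPolynomial (Option σ) ℂ) ^ M *
        (rename some (C κ * monomial β 1) + X none * Q) := by
  obtain ⟨M₁, β₁, κ₁, Q₁, hκ₁, rfl⟩ := hf
  obtain ⟨M₂, β₂, κ₂, Q₂, hκ₂, rfl⟩ := hg
  refine ⟨M₁ + M₂, β₁ + β₂, κ₁ * κ₂,
    rename some (C κ₁ * monomial β₁ 1) * Q₂ + Q₁ * rename some (C κ₂ * monomial β₂ 1) +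
      X none * Q₁ * Q₂, mul_ne_zero hκ₁ hκ₂, ?_⟩
  have hm : rename some (C (κ₁ * κ₂) * monomial (β₁ + β₂) (1 : ℂ)) =
      rename some (C κ₁ * monomial β₁ 1) * rename some (C κ₂ * monomial β₂ 1) := by
    rw [← map_mul, mul_mul_mul_comm, ← map_mul, monomial_mul, mul_one]
  rw [hm]
  ring

/-- **(b)** for a product of non-zero affine forms: `θ (Π_j ℓ_j) = τ^M (κ x^β + τ Q)` with
`κ ≠ 0`, for the torus `x_v ↦ τ^{w v} x_v` with injective weights `w ≥ 1`. [folklore] -/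
theorem prod_affine_datum [Fintype σ] [DecidableEq σ] (w : σ → ℕ) (hw : Function.Injective w)
    (hpos : ∀ v, 1 ≤ w v) {D : ℕ} (lam : Fin D → MvPolynomial σ ℂ)
    (hdeg : ∀ j, (lam j).totalDegree ≤ 1) (hne : ∀ j, lam j ≠ 0) :
    ∃ (M : ℕ) (β : σ →₀ ℕ) (κ : ℂ) (Q : MvPolynomial (Option σ) ℂ), κ ≠ 0 ∧
      aeval (fun v : σ => (X none : MvPolynomial (Option σ) ℂ) ^ w v * X (some v)) (∏ j, lam j) =
        (X none : MvPolynomial (Option σ) ℂ) ^ M *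
          (rename some (C κ * monomial β 1) + X none * Q) := by
  rw [map_prod]
  exact Finset.prod_induction _
    (fun F => ∃ (M : ℕ) (β : σ →₀ ℕ) (κ : ℂ) (Q : MvPolynomial (Option σ) ℂ), κ ≠ 0 ∧
      F = (X none : MvPolynomial (Option σ) ℂ) ^ M *
        (rename some (C κ * monomial β 1) + X none * Q))
    (fun _ _ ha hb => mul_datum ha hb) one_datum
    fun j _ => affine_datum w hw hpos (hdeg j) (hne j)

end Datum

/-- The weights `wt (i, j) = n·i + j + 1` are injective on `Fin n × Fin n`. [folklore] -/
theorem weight_injective (n : ℕ) :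
    Function.Injective fun v : Fin n × Fin n => n * (v.1 : ℕ) + (v.2 : ℕ) + 1 := by
  intro v v' h
  have h' : ((finProdFinEquiv v : Fin (n * n)) : ℕ) = ((finProdFinEquiv v' : Fin (n * n)) : ℕ) := by
    simp only [finProdFinEquiv_apply_val]
    dsimp only at h
    omega
  exact finProdFinEquiv.injective (Fin.ext h')

/-- **Stub `stub_degenerationDatum`** (registered stub W6 of crux stmt-ValiantsHypothesis-5936,
line `registered`): for the torus `x_{(i,j)} ↦ τ^{n i + j + 1} x_{(i,j)}` (`τ = X none`),
(a) the permanent is a semi-invariant, `θ per_n = τ^{Σ_i (n i + (i+1))} · per_n`, and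
(b) every product of non-zero affine forms degenerates to a non-zero scalar multiple of a
monomial, `θ (Π_j ℓ_j) = τ^M (κ x^β + τ Q)` with `κ ≠ 0`. -/
theorem stub_degenerationDatum :
    (∀ n : ℕ, MvPolynomial.aeval (fun v : Fin n × Fin n => (MvPolynomial.X (none : Option (Fin n × Fin n)) : MvPolynomial (Option (Fin n × Fin n)) ℂ) ^ (n * (v.1 : ℕ) + (v.2 : ℕ) + 1) * MvPolynomial.X (some v)) (Literature.Computability.AlgebraicComplexity.perPoly (Fin n) ℂ) =
        (MvPolynomial.X (none : Option (Fin n × Fin n)) : MvPolynomial (Option (Fin n × Fin n)) ℂ) ^ (∑ i : Fin n, (n * (i : ℕ) + ((i : ℕ) + 1))) *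
          MvPolynomial.rename some (Literature.Computability.AlgebraicComplexity.perPoly (Fin n) ℂ)) ∧
    (∀ (n D : ℕ) (lam : Fin D → MvPolynomial (Fin n × Fin n) ℂ), (∀ j, (lam j).totalDegree ≤ 1) →
      (∀ j, lam j ≠ 0) → ∃ (M : ℕ) (β : (Fin n × Fin n) →₀ ℕ) (κ : ℂ) (Q : MvPolynomial (Option (Fin n × Fin n)) ℂ), κ ≠ 0 ∧
        MvPolynomial.aeval (fun v : Fin n × Fin n => (MvPolynomial.X (none : Option (Fin n × Fin n)) : MvPolynomial (Option (Fin n × Fin n)) ℂ) ^ (n * (v.1 : ℕ) + (v.2 : ℕ) + 1) * MvPolynomial.X (some v)) (∏ j, lam j) =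
          (MvPolynomial.X (none : Option (Fin n × Fin n)) : MvPolynomial (Option (Fin n × Fin n)) ℂ) ^ M *
            (MvPolynomial.rename some (MvPolynomial.C κ * MvPolynomial.monomial β 1) + (MvPolynomial.X (none : Option (Fin n × Fin n)) : MvPolynomial (Option (Fin n × Fin n)) ℂ) * Q)) := by
  refine ⟨aeval_torus_perPoly, fun n D lam hdeg hne => ?_⟩
  exact prod_affine_datum (fun v : Fin n × Fin n => n * (v.1 : ℕ) + (v.2 : ℕ) + 1)
    (weight_injective n) (fun v => Nat.succ_pos _) lam hdeg hne

end Summit.ValiantsHypothesis.ValiantsHypothesis.Theorems.ChowBorderBound.DegenerationDatum
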